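import Mathlib
import HarnessLib

/-!
# Route `IntegerScrew` — the σ-MODEL's Chapman–Kolmogorov identity behind CONJECTURE T's closed form
# (CONTINUUM-LIMIT 23.17 (e)): averaging the two-time return factors `r_p(t)r_p(t′)` over the random prime set
# `S` (`p ∈ S` with probability `1/p`) turns `Ψ(t)Ψ(t′)` into `Ψ(t+t′)`

In the grand-canonical σ-model of PIVOT-LAW 13.33 / CONTINUUM-LIMIT §18 each prime `p` is an independent
two-state chain («absent»/«present», stationary odds `1 : 1/(p−1)`, relaxation `y_p(t) = e^{−tλ_p}`): the
return-to-absent factor from «absent» is `m_p(t;0) ∝ 1 + y_p(t)/(p−1)` (the factor of `Ψ(t) = Π_p(1 + y_p/(p−1))`)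
and from «present» it is smaller by `r_p(t) = (p−1)(1−y_p)/(p−1+y_p)`.  CONJECTURE T (23.17) writes the tilt
constant as `c_ε·E_S[J_σ(S)²]` with `J_σ(S) = ∫e^{−σt}Ψ(t)Π_{p∈S}r_p(t)dt`, and 23.17 (e) evaluates the
expectation by the identity proved here (for any finite set of «primes», i.e. reals `p > 1`, and any
relaxation values `y, y′` — with `y_p(t)y_p(t′) = y_p(t+t′)` this is Chapman–Kolmogorov):

* `twoState_ck` — `[(1 − 1/p) + (1/p)·r(y)·r(y′)]·(1 + y/(p−1))·(1 + y′/(p−1)) = 1 + y·y′/(p−1)`;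
* `sigmaModel_ck` — **`(Σ_{S ⊆ P} Π_{p∈S}(r_p(y)r_p(y′)/p)·Π_{p∈P∖S}(1 − 1/p)) · Π_{p∈P}(1 + y_p/(p−1)) · Π_{p∈P}(1 + y′_p/(p−1))
  = Π_{p∈P}(1 + y_p y′_p/(p−1))`** — i.e. `E_S[Π_{p∈S}r_p(t)r_p(t′)]·Ψ_P(t)Ψ_P(t′) = Ψ_P(t+t′)`.

Pure algebra (`Finset.prod_add`); RH-free and walk-free; nothing here bears on the truth of RH.  References:
CONTINUUM-LIMIT §18.0–18.1 (the two-state factors), §23.17 (e) (rh-explicit A6-PIVOT); M. Suzuki, J. Lond.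
Math. Soc. (2) 108 (2023) 1448–1487 [Suzuki2023] for the screw matrices whose pivot law this serves.
-/

noncomputable section

-- D-0017: `Summit.<S>.<S>.…` is the designed namespace of a single-problem summit.
set_option linter.dupNamespace false

namespace Summit.RiemannHypothesis.RiemannHypothesis.Theorems.IntegerScrew

open Finset

/-- **The two-state Chapman–Kolmogorov identity**: for `p > 1` and `y, y′ > 1 − p` (in the model `y, y′ ∈ (0, 1]`),
`[(1 − 1/p) + (1/p)·r(y)r(y′)]·(1 + y/(p−1))(1 + y′/(p−1)) = 1 + yy′/(p−1)` with `r(y) = (p−1)(1−y)/(p−1+y)`. -/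
theorem twoState_ck {p y y' : ℝ} (hp : 1 < p) (hy : 0 < p - 1 + y) (hy' : 0 < p - 1 + y') :
    ((1 - 1 / p) + (1 / p) * ((p - 1) * (1 - y) / (p - 1 + y)) * ((p - 1) * (1 - y') / (p - 1 + y'))) *
        (1 + y / (p - 1)) * (1 + y' / (p - 1)) = 1 + y * y' / (p - 1) := by
  have hp0 : p ≠ 0 := by linarith
  have hp1 : p - 1 ≠ 0 := by linarith
  field_simp
  ring

/-- **The σ-model's Chapman–Kolmogorov identity over a finite set of primes** (CONTINUUM-LIMIT 23.17 (e)):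
averaging `Π_{p∈S} r_p(y)r_p(y′)` over `S ⊆ P` with the independent inclusion probabilities `1/p` and multiplying
by `Ψ_P(y)Ψ_P(y′) = Π_{p∈P}(1 + y_p/(p−1))(1 + y′_p/(p−1))` gives `Ψ_P(y·y′) = Π_{p∈P}(1 + y_py′_p/(p−1))`. -/
theorem sigmaModel_ck {ι : Type*} [DecidableEq ι] (P : Finset ι) (p y y' : ι → ℝ) (hp : ∀ i ∈ P, 1 < p i)
    (hy : ∀ i ∈ P, 0 < p i - 1 + y i) (hy' : ∀ i ∈ P, 0 < p i - 1 + y' i) :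
    (∑ S ∈ P.powerset,
        (∏ i ∈ S, (1 / p i) * ((p i - 1) * (1 - y i) / (p i - 1 + y i)) *
            ((p i - 1) * (1 - y' i) / (p i - 1 + y' i))) *
          ∏ i ∈ P \ S, (1 - 1 / p i)) *
        (∏ i ∈ P, (1 + y i / (p i - 1))) * (∏ i ∈ P, (1 + y' i / (p i - 1))) =
      ∏ i ∈ P, (1 + y i * y' i / (p i - 1)) := by
  -- the sum over S is the expansion of Π_i [(1/p) r r' + (1 − 1/p)]
  rw [← Finset.prod_add, ← Finset.prod_mul_distrib, ← Finset.prod_mul_distrib]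
  refine Finset.prod_congr rfl fun i hi => ?_
  have h := twoState_ck (hp i hi) (hy i hi) (hy' i hi)
  rw [← h]
  ring

/-- The inclusion weights are a probability: `Σ_{S ⊆ P} Π_{p∈S}(1/p)·Π_{p∈P∖S}(1 − 1/p) = 1`. -/
theorem sigmaModel_weights_sum_one {ι : Type*} [DecidableEq ι] (P : Finset ι) (p : ι → ℝ) :
    ∑ S ∈ P.powerset, (∏ i ∈ S, 1 / p i) * ∏ i ∈ P \ S, (1 - 1 / p i) = 1 := by
  rw [← Finset.prod_add]
  exact Finset.prod_eq_one fun i _ => by ring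

/-- The first moment: `Σ_S w(S)·Π_{p∈S}r_p(y) · Ψ_P(y) = Π_{p∈P} 1 = 1`… more precisely
`[(1 − 1/p) + (1/p)r(y)]·(1 + y/(p−1)) = 1` per prime, so `E_S[Π_{p∈S}r_p(y)]·Ψ_P(y) = 1` — the normalization
behind `E[J_σ] = 1/σ` in 23.17 (d). -/
theorem twoState_mean {p y : ℝ} (hp : 1 < p) (hy : 0 < p - 1 + y) :
    ((1 - 1 / p) + (1 / p) * ((p - 1) * (1 - y) / (p - 1 + y))) * (1 + y / (p - 1)) = 1 := by
  have hp0 : p ≠ 0 := by linarith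
  have hp1 : p - 1 ≠ 0 := by linarith
  field_simp
  ring

/-- Product form of the first moment: `(Σ_S Π_{S}(r_p(y)/p)·Π_{P∖S}(1 − 1/p))·Π_P(1 + y_p/(p−1)) = 1`. -/
theorem sigmaModel_mean {ι : Type*} [DecidableEq ι] (P : Finset ι) (p y : ι → ℝ) (hp : ∀ i ∈ P, 1 < p i)
    (hy : ∀ i ∈ P, 0 < p i - 1 + y i) :
    (∑ S ∈ P.powerset,
        (∏ i ∈ S, (1 / p i) * ((p i - 1) * (1 - y i) / (p i - 1 + y i))) * ∏ i ∈ P \ S, (1 - 1 / p i)) *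
        ∏ i ∈ P, (1 + y i / (p i - 1)) = 1 := by
  rw [← Finset.prod_add, ← Finset.prod_mul_distrib]
  exact Finset.prod_eq_one fun i hi => by rw [add_comm]; exact twoState_mean (hp i hi) (hy i hi)

end Summit.RiemannHypothesis.RiemannHypothesis.Theorems.IntegerScrew

end
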